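import Mathlib
import Literature.Analysis.Calculus.ParametricContraction

/-!
# Chord-method (Krawczyk-type) zero lemma in a Banach space, with parameters
(solo-blind, PLATEAU: the certification primitive for the frozen slow eigenvalue, paper §24.95(5))

The slow eigenvalue `λ(t;P)` of the ideal chain is the zero of an explicit two-dimensional
shooting map `G_{t,P}`; Newton from the closed form converges.  To CERTIFY such a zero (interval
Newton / Krawczyk) one uses the chord map `N z = z - Y (G z)` with a fixed approximate inverse
`Y` of the Jacobian: if `N` is `θ`-Lipschitz on the closed ball `B(z₀, r)` with `θ < 1` and the
defect satisfies `‖Y (G z₀)‖ ≤ (1 - θ) r`, then `Y ∘ G` has exactly one zero in the ball; with a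
parameter `p` (here `(t, P)`) ranging over a set `S` on which these bounds hold uniformly and
`p ↦ N_p z` is continuous, the zero depends continuously on `p` — which is the joint continuity
the window/plateau bookkeeping needs.  This is a direct corollary of the contraction mapping
principle with a parameter, `Literature.Analysis.Calculus.exists_fixedPoint_continuousOn_of_isClosed`
[cite: Copson1968, §80]; we only supply the maps-to computation of the chord method.
-/

namespace Summit.AnomalousDissipation.AnomalousDissipation.Theorems

open Metric Set

variable {P E : Type*} [TopologicalSpace P] [NormedAddCommGroup E] [CompleteSpace E]

/-- **Parametric chord-method zero lemma.** For `p ∈ S` let `N p z := z - Y p (G p z)` be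
`θ`-Lipschitz on `closedBall z₀ r` (`θ < 1`, `0 ≤ r`) with defect `‖Y p (G p z₀)‖ ≤ (1 - θ) r`, and let
`p ↦ N p z` be continuous on `S` for each `z` in the ball.  Then there is `ζ : P → E`, continuous on
`S`, with `ζ p ∈ closedBall z₀ r` and `Y p (G p (ζ p)) = 0` for `p ∈ S`, and `ζ p` is the only zero
of `Y p ∘ G p` in the ball. -/
theorem chord_zero_parametric {S : Set P} (G Y : P → E → E) (z₀ : E) {r : ℝ} (hr : 0 ≤ r)
    {θ : NNReal} (hθ : θ < 1)
    (hlip : ∀ p ∈ S, LipschitzOnWith θ (fun z => z - Y p (G p z)) (closedBall z₀ r))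
    (hdef : ∀ p ∈ S, ‖Y p (G p z₀)‖ ≤ (1 - (θ : ℝ)) * r)
    (hc : ∀ z ∈ closedBall z₀ r, ContinuousOn (fun p => z - Y p (G p z)) S) :
    ∃ ζ : P → E, ContinuousOn ζ S ∧ (∀ p ∈ S, ζ p ∈ closedBall z₀ r ∧ Y p (G p (ζ p)) = 0) ∧
      ∀ p ∈ S, ∀ y ∈ closedBall z₀ r, Y p (G p y) = 0 → y = ζ p := by
  set B := closedBall z₀ r with hB
  have hmaps : ∀ p ∈ S, MapsTo (fun z => z - Y p (G p z)) B B := by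
    intro p hp z hz
    rw [hB, mem_closedBall] at hz ⊢
    have h1 : dist (z - Y p (G p z)) (z₀ - Y p (G p z₀)) ≤ θ * dist z z₀ :=
      (hlip p hp).dist_le_mul z (by rw [mem_closedBall]; exact hz) z₀ (mem_closedBall_self hr)
    have h2 : dist (z₀ - Y p (G p z₀)) z₀ = ‖Y p (G p z₀)‖ := by
      rw [dist_eq_norm]; simp
    have hθr : (θ : ℝ) * dist z z₀ ≤ θ * r := mul_le_mul_of_nonneg_left hz θ.coe_nonneg
    calc dist (z - Y p (G p z)) z₀
        ≤ dist (z - Y p (G p z)) (z₀ - Y p (G p z₀)) + dist (z₀ - Y p (G p z₀)) z₀ := dist_triangle _ _ _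
      _ ≤ θ * r + (1 - (θ : ℝ)) * r := by rw [h2]; exact add_le_add (h1.trans hθr) (hdef p hp)
      _ = r := by ring
  obtain ⟨ζ, hζc, hζfix, hζuniq⟩ :=
    Literature.Analysis.Calculus.exists_fixedPoint_continuousOn_of_isClosed (P := P) (X := E)
      (S := S) (B := B) isClosed_closedBall ⟨z₀, mem_closedBall_self hr⟩ hθ
      (T := fun p z => z - Y p (G p z)) hmaps hlip hc
  refine ⟨ζ, hζc, fun p hp => ⟨(hζfix p hp).1, ?_⟩, fun p hp y hy hy0 => ?_⟩
  · have h := (hζfix p hp).2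
    -- h : ζ p - Y p (G p (ζ p)) = ζ p
    simpa [sub_eq_self] using h
  · exact hζuniq p hp y hy (by simp [hy0])

/-- **Chord-method zero lemma (no parameter).** If `z ↦ z - Y (G z)` is `θ`-Lipschitz on
`closedBall z₀ r` with `θ < 1`, `0 ≤ r`, and `‖Y (G z₀)‖ ≤ (1 - θ) r`, then `Y ∘ G` has exactly one
zero in the ball. -/
theorem chord_zero (G Y : E → E) (z₀ : E) {r : ℝ} (hr : 0 ≤ r) {θ : NNReal} (hθ : θ < 1)
    (hlip : LipschitzOnWith θ (fun z => z - Y (G z)) (closedBall z₀ r))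
    (hdef : ‖Y (G z₀)‖ ≤ (1 - (θ : ℝ)) * r) :
    ∃ z ∈ closedBall z₀ r, Y (G z) = 0 ∧ ∀ y ∈ closedBall z₀ r, Y (G y) = 0 → y = z := by
  obtain ⟨ζ, -, hζ, huniq⟩ := chord_zero_parametric (P := Unit) (S := univ) (fun _ => G) (fun _ => Y)
    z₀ hr hθ (fun _ _ => hlip) (fun _ _ => hdef) (fun _ _ => continuousOn_const)
  exact ⟨ζ (), (hζ () (mem_univ _)).1, (hζ () (mem_univ _)).2,
    fun y hy hy0 => huniq () (mem_univ _) y hy hy0⟩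

/-- If moreover `Y` is injective and `Y 0 = 0` (e.g. `Y` linear and invertible), the unique zero of
`Y ∘ G` in the ball is the unique zero of `G` there. -/
theorem chord_zero_of_injective (G Y : E → E) (hY : Function.Injective Y) (hY0 : Y 0 = 0) (z₀ : E)
    {r : ℝ} (hr : 0 ≤ r) {θ : NNReal} (hθ : θ < 1)
    (hlip : LipschitzOnWith θ (fun z => z - Y (G z)) (closedBall z₀ r))
    (hdef : ‖Y (G z₀)‖ ≤ (1 - (θ : ℝ)) * r) :
    ∃ z ∈ closedBall z₀ r, G z = 0 ∧ ∀ y ∈ closedBall z₀ r, G y = 0 → y = z := by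
  obtain ⟨z, hz, hz0, huniq⟩ := chord_zero G Y z₀ hr hθ hlip hdef
  refine ⟨z, hz, ?_, fun y hy hy0 => huniq y hy (by rw [hy0, hY0])⟩
  apply hY; rw [hz0, hY0]

end Summit.AnomalousDissipation.AnomalousDissipation.Theorems
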